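import Summits.ResolutionOfSingularities.ResolutionOfSingularities.Theorems.FrobeniusClosingSteerCore4IsoIsolCompletion
import Mathlib.RingTheory.Length
import HarnessLib

/-!
# Crux `Steer` (stmt-ResolutionOfSingularities-16345), chain W4.1, hG3 / G-geom WORK-DIRECT: Lemma F♭ PART 3b(E) — the Jacobian colength
# `ℓ(A ⧸ 𝒥_abs(a))` is invariant under ring isomorphisms

OURS (campaign `res-hironaka`, rung L ★L-G4, slot W4.1; seat res-L0-w41-stub-2 g6; replaces the role of no printed item; NOT a statement of the manuscript
under review [claim: Hironaka2017, status: under-review]; AI-produced). Theses-free, definition-free.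

* `JacobianLength.image_range_derivation_apply` — a ring isomorphism `e : A ≃+* B` carries the set `{D a : D ∈ Der_ℤ(A)}` onto `{D' (e a) : D' ∈ Der_ℤ(B)}`
  (conjugation, res-L0-w41-stub-2 p478623 `Isol.exists_derivation_ringEquiv_conj`), hence `𝒥_abs(a)·B = 𝒥_abs(e a)`;
* `JacobianLength.length_quotient_map_ringEquiv` — `ℓ_A(A ⧸ J) = ℓ_B(B ⧸ e(J))` for any ideal (order isomorphism of submodule lattices along the
  semilinear bijection `A ⧸ J → B ⧸ e(J)`);
* `JacobianLength.length_quotient_jacobian_eq_of_ringEquiv` — **`τ_abs` is intrinsic**: `ℓ_B(B ⧸ 𝒥_abs(e a)) = ℓ_A(A ⧸ 𝒥_abs(a))`.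
Consumer: PART 3b(D) (the fuel `τ` of a free chain is read in different Cohen frames of `Ŝ₀`, one per length `M`). [folklore]
-/

noncomputable section

set_option linter.dupNamespace false

namespace Summit.ResolutionOfSingularities.ResolutionOfSingularities.Theorems.SwitchingDichotomy.JacobianLength

universe u v

variable {A : Type u} {B : Type v} [CommRing A] [CommRing B] (e : A ≃+* B)

/-- Conjugation by a ring isomorphism identifies the values of `ℤ`-derivations: `e '' {D a} = {D' (e a)}`. [folklore] -/
theorem image_range_derivation_apply (a : A) :
    (e : A → B) '' Set.range (fun D : Derivation ℤ A A => D a) = Set.range (fun D' : Derivation ℤ B B => D' (e a)) := by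
  ext b
  constructor
  · rintro ⟨_, ⟨D, rfl⟩, rfl⟩
    obtain ⟨D', hD'⟩ := Isol.exists_derivation_ringEquiv_conj e D
    exact ⟨D', hD' a⟩
  · rintro ⟨D', rfl⟩
    obtain ⟨D, hD⟩ := Isol.exists_derivation_ringEquiv_conj e.symm D'
    refine ⟨D a, ⟨D, rfl⟩, ?_⟩
    have h := hD (e a)
    rw [e.symm_apply_apply] at h
    change e (D a) = D' (e a)
    rw [h, e.apply_symm_apply]

/-- The absolute Jacobian ideal is transported by `e`: `(𝒥_abs(a)).map e = 𝒥_abs(e a)`. [folklore] -/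
theorem map_span_range_derivation_apply (a : A) :
    (Ideal.span (Set.range fun D : Derivation ℤ A A => D a)).map (e : A →+* B) =
      Ideal.span (Set.range fun D' : Derivation ℤ B B => D' (e a)) := by
  rw [Ideal.map_span, ← image_range_derivation_apply e a]
  rfl

/-- **Lengths of quotients are invariant under ring isomorphisms**: `ℓ_A(A ⧸ J) = ℓ_B(B ⧸ e(J))` (the quotient map `A ⧸ J → B ⧸ e(J)` is an
`e`-semilinear bijection, so the submodule lattices are order-isomorphic). [folklore] -/
theorem length_quotient_map_ringEquiv (J : Ideal A) :
    Module.length A (A ⧸ J) = Module.length B (B ⧸ J.map (e : A →+* B)) := by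
  haveI : RingHomSurjective (e : A →+* B) := ⟨e.surjective⟩
  let q : A ⧸ J ≃+* B ⧸ J.map (e : A →+* B) := Ideal.quotientEquiv J (J.map (e : A →+* B)) e rfl
  have hq : ∀ x : A, q (Ideal.Quotient.mk J x) = Ideal.Quotient.mk (J.map (e : A →+* B)) (e x) := fun x =>
    Ideal.quotientEquiv_mk J (J.map (e : A →+* B)) e rfl x
  let f : (A ⧸ J) →ₛₗ[(e : A →+* B)] (B ⧸ J.map (e : A →+* B)) :=
    { toFun := q
      map_add' := fun x y => map_add q x y
      map_smul' := by
        intro c x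
        obtain ⟨x, rfl⟩ := Ideal.Quotient.mk_surjective x
        rw [Algebra.smul_def, Algebra.smul_def, Ideal.Quotient.algebraMap_eq, Ideal.Quotient.algebraMap_eq, ← map_mul, hq, hq,
          map_mul, map_mul, RingHom.coe_coe] }
  have hbij : Function.Bijective f := q.bijective
  apply WithBot.coe_injective
  rw [Module.coe_length, Module.coe_length]
  exact Order.krullDim_eq_of_orderIso (Submodule.orderIsoMapComapOfBijective f hbij)

/-- **The Jacobian colength is intrinsic**: for a ring isomorphism `e : A ≃+* B` and `a ∈ A`,
`ℓ_B(B ⧸ (D′(e a))_{D′ ∈ Der_ℤ(B)}) = ℓ_A(A ⧸ (D a)_{D ∈ Der_ℤ(A)})`. [folklore] -/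
theorem length_quotient_jacobian_eq_of_ringEquiv (a : A) :
    Module.length B (B ⧸ Ideal.span (Set.range fun D' : Derivation ℤ B B => D' (e a))) =
      Module.length A (A ⧸ Ideal.span (Set.range fun D : Derivation ℤ A A => D a)) := by
  rw [← map_span_range_derivation_apply e a, ← length_quotient_map_ringEquiv e]

end Summit.ResolutionOfSingularities.ResolutionOfSingularities.Theorems.SwitchingDichotomy.JacobianLength

end
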